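import Mathlib
import Summits.NavierStokesRegularity.NavierStokesRegularity.Theorems.WakeRatchetTailRatchetTruncatedPositivity
import Summits.NavierStokesRegularity.NavierStokesRegularity.Theorems.WakeRatchetTailRatchetTruncationLimit
import HarnessLib

/-!
# `WakeRatchet.TailRatchet` (stmt-NavierStokesRegularity-21808): the FAR-WAKE box of the truncated
# dyadic one-period map is invariant up to drift (brick R1a of the stub-A analogue)

Support file for the crux `TailRatchet` (route `WakeRatchet`; MODEL lattice ODEs of Tao 2016 §4 —
nothing here is a statement about the Navier–Stokes equations).  Companion of
`…TruncatedPositivity` / `…LeadingEdge` / `…WakeEnvelope`: far behind the front the shells of the dyadic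
cascade are quasi-static over one period, and a WIDE geometric box `x_n ∈ [L⁻ cmaxⁿ, L⁺ cminⁿ]` (for a
floating ratio `c = (1+T)/Λ ∈ [cmin, cmax]`) is reproduced by the one-period map
`x ↦ c⁻¹ Z_{n+1}(T)` as long as the drift is absorbed; the sharp ratio is then recovered a posteriori by
`wake_envelope_of_matching`.

* `truncated_drift_le` — drift of an active shell of the `K`-truncated lattice from its all-time box
  (mean value inequality with `dyadRHS_bound`);
* `wake_onePeriod_mem` — the interval bookkeeping: start interval `[lo,hi]` for shell `n+1`, drift `≤ D`,
  target `[lo',hi']` for shell `n` with `lo' ≤ cmax⁻¹(lo−D)`, `cmin⁻¹(hi+D) ≤ hi'` ⟹ the image is in the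
  target for every `c ∈ [cmin,cmax]`.

(Validity range, numbers: with constant flux `Π` and wake level `L` the crude relative drift per period at
`|m|` shells behind the front is `≍ (2ΠT/L²) μ^{|m|}`, `μ = c²`; the bookkeeping above closes only where
this is small, i.e. in the FAR wake `|m| ≳ ε₀⁻¹ log ε₀⁻¹` as `ε₀ → 0`; the near wake needs a flux tube —
see `…ConjugateBox` and the item's evidence memo.)

HONEST FRAMING: elementary estimates for a finite-dimensional MODEL ODE; no registered stub is closed, no
summit statement is touched.
-/

noncomputable section

set_option linter.dupNamespace false

namespace Summit.NavierStokesRegularity.NavierStokesRegularity.Theorems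

namespace WakeRatchetLatticePeriod

open Set Filter Topology

/-- **Drift of a truncated solution from its all-time box (mean value inequality).**  For the
`K`-truncated dyadic lattice in the box `|Z_n| ≤ b_n` on `[0,T']`, every active shell `|n| ≤ K` moves by at
most `(|Λ^{n-1}| b_{n-1}² + |Λ^n| b_n b_{n+1}) t` up to time `t`. [elementary; `dyadRHS_bound`] -/
theorem truncated_drift_le {L : ℝ} {K : ℕ} {T' : ℝ} {Z : ℤ → ℝ → ℝ} (b : ℤ → ℝ)
    (hD : ∀ n : ℤ, |n| ≤ (K : ℤ) → ∀ t ∈ Icc (0 : ℝ) T', HasDerivWithinAt (Z n)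
      (L ^ (n - 1) * Z (n - 1) t ^ 2 - L ^ n * Z n t * Z (n + 1) t) (Icc (0 : ℝ) T') t)
    (hb : ∀ n : ℤ, ∀ t ∈ Icc (0 : ℝ) T', |Z n t| ≤ b n) {n : ℤ} (hn : |n| ≤ (K : ℤ)) :
    ∀ t ∈ Icc (0 : ℝ) T',
      |Z n t - Z n 0| ≤ (|L ^ (n - 1)| * b (n - 1) ^ 2 + |L ^ n| * (b n * b (n + 1))) * t := by
  intro t ht
  have h := norm_image_sub_le_of_norm_deriv_le_segment' (f := Z n) (a := 0) (b := T')
    (C := |L ^ (n - 1)| * b (n - 1) ^ 2 + |L ^ n| * (b n * b (n + 1)))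
    (fun s hs => hD n hn s hs) (fun s hs => by
      rw [Real.norm_eq_abs]
      exact dyadRHS_bound L b n (fun k => Z k s) fun k => hb k s (Ico_subset_Icc_self hs)) t ht
  rw [Real.norm_eq_abs, sub_zero] at h
  exact h

/-- **Far-wake box of the one-period map: invariance up to drift (brick R1a of the stub-A analogue).**
If shell `n+1` starts in `[lo, hi]`, drifts by at most `D` over the period, and the target interval
`[lo', hi']` for shell `n` absorbs the rescaled drifted interval for EVERY admissible ratio
`c ∈ [cmin, cmax]` — `lo' ≤ (hi-independent) cmax⁻¹ (lo − D)` and `cmin⁻¹ (hi + D) ≤ hi'`, with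
`lo − D ≥ 0` — then the one-period image `c⁻¹ Z_{n+1}(T)` lies in `[lo', hi']`.  (With
`truncated_drift_le` this is the wide geometric wake box `x_n ∈ [L⁻ cmaxⁿ, L⁺ cminⁿ]` of the census: it is
reproduced whenever the relative drift is absorbed by the widening; the SHARP ratio is recovered afterwards
by `wake_envelope_of_matching`.) [elementary] -/
theorem wake_onePeriod_mem {Z : ℤ → ℝ → ℝ} {n : ℤ} {T lo hi D lo' hi' c cmin cmax : ℝ}
    (hcmin : 0 < cmin) (hc1 : cmin ≤ c) (hc2 : c ≤ cmax)
    (hx : lo ≤ Z (n + 1) 0 ∧ Z (n + 1) 0 ≤ hi) (hdrift : |Z (n + 1) T - Z (n + 1) 0| ≤ D)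
    (hloD : 0 ≤ lo - D) (hlo' : lo' ≤ cmax⁻¹ * (lo - D)) (hhi' : cmin⁻¹ * (hi + D) ≤ hi') :
    lo' ≤ c⁻¹ * Z (n + 1) T ∧ c⁻¹ * Z (n + 1) T ≤ hi' := by
  have hc : 0 < c := lt_of_lt_of_le hcmin hc1
  have hcmax : 0 < cmax := lt_of_lt_of_le hc hc2
  obtain ⟨hd1, hd2⟩ := abs_le.1 hdrift
  have hZlo : lo - D ≤ Z (n + 1) T := by linarith [hx.1]
  have hZhi : Z (n + 1) T ≤ hi + D := by linarith [hx.2]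
  have hZ0 : 0 ≤ Z (n + 1) T := hloD.trans hZlo
  constructor
  · calc lo' ≤ cmax⁻¹ * (lo - D) := hlo'
      _ ≤ c⁻¹ * (lo - D) := mul_le_mul_of_nonneg_right (inv_anti₀ hc hc2) hloD
      _ ≤ c⁻¹ * Z (n + 1) T := mul_le_mul_of_nonneg_left hZlo (inv_nonneg.2 hc.le)
  · calc c⁻¹ * Z (n + 1) T ≤ cmin⁻¹ * Z (n + 1) T :=
          mul_le_mul_of_nonneg_right (inv_anti₀ hcmin hc1) hZ0
      _ ≤ cmin⁻¹ * (hi + D) := mul_le_mul_of_nonneg_left hZhi (inv_nonneg.2 hcmin.le)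
      _ ≤ hi' := hhi'

end WakeRatchetLatticePeriod

end Summit.NavierStokesRegularity.NavierStokesRegularity.Theorems

end
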